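import Literature.AlgebraicGeometry.AbelianVarieties.StructureSheafSemiHomogeneous
import HarnessLib

/-!
# Pull-back of the direct image along an isogeny: `g^*(g_*F) ≅ ⨁_{x ∈ Ker g} τ_x^*F` (named fact)

For an isogeny `g : A → B` of abelian varieties with (finite) kernel `K = Ker g` and a quasi-coherent `𝒪_A`-module `F`, the
pull-back of the direct image splits into the translates of `F` by the kernel points:
**`g^*(g_*F) ≅ ⨁_{x ∈ K} τ_x^*F`**, `τ_x : A → A` the translation by `x`. This is the standard description of `π^*π_*` for the
quotient `π : X → X/K` of an abelian variety by a finite (étale) subgroup, assembled from three printed results: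

* D. Mumford, *Abelian Varieties* (1970), §7 «Quotients by finite groups», Thm. 4 (p. 72): for a finite subgroup `K ⊂ X` the
  quotient `X → X/K` exists and is a separable isogeny with kernel `K`, and conversely every separable isogeny between abelian
  varieties is of this form (in characteristic `0` every isogeny is separable — in the tree: `AbelianVariety.IsIsogeny.etale`,
  `Motives/AbelianVarietyIsogenyEtale`); §7 Thm. 1 / Prop. 2: `π : X → X/K` is an fppf (indeed étale) `K`-torsor and coherent
  sheaves on `X/K` are the `K`-equivariant coherent sheaves on `X`.
* U. Görtz, T. Wedhorn, *Algebraic Geometry II* (2023), (27.9.1)–(27.9.2) and Prop. 27.62 (2): for `f : G → G/H` one has the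
  cartesian square `G ×_S H = G ×_{G/H} G`, `(g, h) ↦ (g, gh)`, i.e. `G → G/H` is an `H`-torsor; for an isogeny `g : A → B`,
  `B ≅ A / Ker g` (Def./Prop. 27.176), so **`A ×_B A ≅ A ×_k Ker g`**, the two projections becoming `pr₁` and the action
  `(a, x) ↦ a + x`; when `Ker g` is the constant group scheme on the finite group `Ker g(k)` (always in characteristic `0` over an
  algebraically closed field: Cartier, Thm. 27.25), `A ×_k Ker g = ∐_{x ∈ Ker g(k)} A` and the second projection is `τ_x` on the
  `x`-th copy.
* The Stacks Project, Tag 02KG (affine base change): for `g` affine (an isogeny is finite, Prop. 27.177 (1)) and `F`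
  quasi-coherent on `A`, the base change map `g^*g_*F → pr_{1*}pr_2^*F` along the cartesian square above is an isomorphism;
  with `pr₁ = ∐ 𝟙_A` and `pr₂ = ∐_x τ_x` this reads `g^*g_*F ≅ ⨁_{x ∈ Ker g(k)} τ_x^*F`.

It is the computation behind S. Mukai, *Semi-homogeneous vector bundles on an abelian variety* (1978), §3 (Prop. 3.12, direct
images of vector bundles along isogenies) and §5 (Prop. 5.4 (1), `π_*(L)` is semi-homogeneous).

## Content (D-0014: a NAMED FACT — `def … : Prop`, no axiom; the tree does not yet have affine base change for
`Scheme.Modules.pushforward ∕ pullback`, nor the shear isomorphism `A ×_B A ≅ A ×_k Ker g`)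

* `IsogenyPullbackPushforwardDecomposition` — the statement over `ℂ`, for vector bundles (finite locally free `F`, the case
  the Hodge road consumes: `Summits/HodgeConjecture/HodgeConjecture/Theorems/VHCAbelianSchemesRoadIsogenyPushforwardChernCharacter`
  derives `g^*ch_k(g_*E•) = #Ker g(ℂ) · ch_k(E•)` in every Chern character theory from it), with Mathlib's
  `Scheme.Modules.pullback ∕ pushforward`, the tree's translations `AbelianVariety.translation` (`Motives/AbelianVarietyTranslation`),
  kernel points `AbelianVariety.Hom.kerPoints (specOver ℂ ℂ) g` (`NumberTheory/DiophantineGeometry/AVIsogenyQuasiInverse`) and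
  `IsFiniteLocallyFree`; the direct sum is the categorical coproduct `∐` over the type `Ker g(ℂ)`, finite for an isogeny
  (`IsIsogeny.finite_kerPoints`), in the abelian category of `𝒪_A`-modules.
* (to be appended, proved: the sanity instance for the identity isogeny — `Ker 𝟙 (ℂ) = 1`, `𝟙^*𝟙_*F ≅ F ≅ τ_1^*F` — showing
  that the shape of the statement, a coproduct over the kernel points of translated pull-backs against Mathlib's pull-back ∕
  push-forward, is the intended one.)

-- TODO(general form): any field `k` and any isogeny `g` whose kernel is a constant group scheme (e.g. `k` algebraically closed
-- of characteristic `0`), `F` quasi-coherent; naturality in `F`; the derived ∕ `K`-equivariant refinements (Mumford §7 Thm. 1).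

## References
* [MumfordAV1970] D. Mumford, Abelian Varieties (1970), §7 Thm. 1, Prop. 2, Thm. 4 (pp. 66–72).
* [GortzWedhorn2023] U. Görtz, T. Wedhorn, Algebraic Geometry II (2023), Thm. 27.25, (27.9.1)–(27.9.2), Prop. 27.62, Def./Prop. 27.176, Prop. 27.177.
* [StacksProject] The Stacks Project, Tag 02KG.
* [Mukai1978] S. Mukai, J. Math. Kyoto Univ. 18 (1978), §3 Prop. 3.12 (p. 249), §5 Prop. 5.4 (p. 259).
-/

noncomputable section

open CategoryTheory CategoryTheory.Limits AlgebraicGeometry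

universe u

namespace Literature.AlgebraicGeometry.Motives

open AbelianVariety

/-- **Pull-back of the direct image along an isogeny splits into the translates by the kernel points** (named fact): for an
isogeny `g : A → B` of complex abelian varieties and a vector bundle (finite locally free `𝒪_A`-module) `F` on `A`,
`g^*(g_*F) ≅ ∐_{x ∈ Ker g(ℂ)} τ_x^*F`, `τ_x` the translation by the kernel point `x`. Assembled in print from: `A → B` is a
`Ker g`-torsor, `A ×_B A ≅ A ×_ℂ Ker g` (Görtz–Wedhorn (27.9.1)–(27.9.2), Prop. 27.62 (2); Mumford §7 Thm. 4: an isogeny is the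
quotient by its finite kernel), `Ker g` is the constant group on `Ker g(ℂ)` in characteristic `0` (Cartier, Thm. 27.25), so
`A ×_B A ≅ ∐_{x ∈ Ker g(ℂ)} A` with projections `𝟙` and `τ_x` on the `x`-th copy, and affine base change for the quasi-coherent
`F` along the finite morphism `g` (Stacks 02KG): `g^*g_*F ≅ pr_{1*}pr_2^*F = ⨁_x τ_x^*F`. Stated over `ℂ` for vector bundles (the
consumers' case); see the module docstring for the general form. [cite: MumfordAV1970, §7 Thm. 4 (p. 72) and §7 Thm. 1]
[cite: GortzWedhorn2023, Prop. 27.62 (2) with (27.9.1)–(27.9.2) and Thm. 27.25] [cite: StacksProject, Tag 02KG] [cite: Mukai1978, §3 Prop. 3.12 (p. 249)] -/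
def IsogenyPullbackPushforwardDecomposition : Prop :=
  ∀ (A B : AbelianVariety ℂ) (g : A ⟶ B), IsIsogeny g →
    ∀ (F : A.X.left.Modules), IsFiniteLocallyFree F →
      Nonempty ((Scheme.Modules.pullback (Hom.toSchemeHom g)).obj ((Scheme.Modules.pushforward (Hom.toSchemeHom g)).obj F) ≅
        ∐ fun x : Hom.kerPoints (specOver ℂ ℂ) g => (Scheme.Modules.pullback (A.translation x.1).left).obj F)

end Literature.AlgebraicGeometry.Motives

end
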